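import Summits.ABC.IUTFork.Joshi.TestATS4HullGainQuantitativeTrivial
import Summits.ABC.IUTFork.Joshi.TestATS4LowerBoundGenuineConverseWitness
import HarnessLib

/-!
# R-J census, row Y-21ℓ — the located converse with REALISING ideles: at genuine tame data whose Θ- AND `q`-ideles realise
# `P_Θ`, `P_q` (print's normalisation), `Statement ∧ ¬Cor91111` as soon as one totally ramified prime supplies the window

Proof-only record file of the abc-iut cell, branch E → R-J «Joshi Y-discharge census» (D-0079; rung LADDER-ABC:A2.RESCUE.J; seat
abc-iut-E-t59, gen 9; part III of p470908 `TestATS4HullGainQuantitative` / p471645 `…Trivial`, closing the HONEST-SCOPE clause of this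
seat's p463394 `TestATS4LowerBoundGenuineConverse` / p464724 `…ConverseWitness`: there the converse «OUR Statement ⟹ Joshi's first
inequality» was REFUTED over every `F ≠ ℚ` with FREE `q`-depth only — for `q`-ideles REALISING `P_q` the window question
«`ℓ⋆·(−|log(Θ)|(𝟙)) ≥` q-granularity» was left undecided). **No side is taken** on [IUTchIII] Cor. 3.12 / [IUTchIV] Thm 1.10, on
[J-III] Cor 9.11.1.1 / [J-IV] Thm 6.10.1 (unrefereed arXiv preprints) or on any author; typed ≠ proved ≠ endorsed; instantiated ≠
endorsed; no definition, no `Prop` fact; every printed relation stays a hypothesis BY NAME.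

Setting: abc-iut-c312-7's genuine print-normalised `Real.settingPrVolSharp X …` for pilot data `X` over `F` whose bad places FILL the
fibres over a finite set `U` of ODD primes UNRAMIFIED in `F`, with `2l·e_v·m_q(p) = ord_v(q_v)` at the places over `p ∈ U` (integral
`q`-depths `m_q(p)`: the arithmetic condition under which realising ideles EXIST at all, plan C-R16 «`2l ∣ ord_v(q_v)`»), and pilot
ideles REALISING `P_Θ`, `P_q` in print's normalisation ([IUTchIII] Rmk. 3.1.1: `log‖t_{Θ,j,v}‖ = −P_{Θ,j}(v)·log|κ(v)|/n_v`,
`log‖t_{q,v}‖ = −P_q(v)·log|κ(v)|/n_v` — the hypotheses `ht`/`htq` of abc-iut-w4-d036 / w5-d107, BY NAME).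
* §1 `qPilot_reading_eq_of_ord` / `thetaPilot_reading_eq_of_ord` — at such data the realising equations READ `‖t_{q,v}‖ = p^{−m_q(p)}`,
  `‖t_{Θ,j,v}‖ = p^{−j²·m_q(p)}` (exponent shape with Θ-exponents `j²·m_q(p)`); `one_le_mq_of_ord` — `m_q(p) ≥ 1` on `U`.
* §2 **`statement_and_not_cor91111_of_realising`** — if ONE prime `p₀` has a SINGLE place `v₀` of `F` above it, of ramification
  index `e ≥ 2`, and the explicit inequality `((ℓ⋆+1)(2ℓ⋆+1)/6 − 1)·Σ_{p∈U} m_q(p)·log p ≤ ((e−1)/e)·((ℓ⋆+1)/2)·log p₀` holds, then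
  for EVERY Thm-3.11 context and ALL realising ideles: **OUR typed Cor. 3.12 `Statement` HOLDS, and `¬ A.Cor91111` for EVERY adelic
  Θ-values-locus datum `A` on `s = U` reading the genuine `q`-volumes (hq) and hull volumes (hV)** (such `A` exist). The exponent gap is
  `((ℓ⋆+1)(2ℓ⋆+1)/6 − 1)·Σ_p m_q(p)·log p > 0` (so Joshi's first inequality, = «gap ≤ 0» by p463394 `cor91111_iff_gap_nonpos`, FAILS),
  and it lies inside the inflation window `(0, −|log(Θ)|(𝟙)]` by part II's `gain_le_negLogTheta_settingPrVolSharp_trivial_of_unique`.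
* §3 `exists_realising_ideles` — NON-VACUITY: under `2l·e_v·m_q(p) = ord_v(q_v)` realising ideles EXIST (`t_{q,v} := p^{m_q(p)}`,
  `t_{Θ,j,v} := p^{j²m_q(p)}` over `U`, units elsewhere).
The sequel `TestATS4LowerBoundGenuineRealisingCyclotomic` INHABITS every hypothesis over `F = ℚ(ζ₅)` (`5` totally ramified, `e = 4`;
`j_E := 3^{−10}`, `S := V(F)₃`, `l := 5`, `m_q(3) = 1`: `(3/2)·log 3 ≤ (9/8)·log 5`). So the converse of Y-21ℓ is REFUTED at genuine
tame data ON PRINT'S OWN NORMALISATION, not only with free `q`-depth. HONEST SCOPE: (Ind2) as typed at the real setting (`Real.ismDH`),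
sharp (Ind3) reading, trivial archimedean container; the Statement holds at these data BY (Ind1)/(Ind2)-INFLATION of the unit boxes at
the ramified packet, «saying nothing about print's intended content» (w4-d107 part 12); vs S unchanged: S-BYPASSED (p447958).
[claim: Joshi2024ATS3, status: disputed] [claim: Mochizuki2012, status: disputed] for the items cited BY NAME;
[cite: DupuyHilado2025, §3.3, §3.4, §3.6, §3.9, §4.7, §4.9] (carriers); [cite: NeukirchANT1999, Ch. II Prop. (6.8)]. Standard axioms.
-/

noncomputable section

open Set Function NumberField IsDedekindDomain Finset
open scoped Pointwise

namespace Summit.ABC.IUTFork.Joshi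

open Thm311 Thm311.Real Cor312 Cor312.Setting Cor312Vol Literature.IUT.LogThetaLattice Literature.IUT.LogVolume
  Literature.IUT.HodgeTheaters Literature.NumberTheory.NumberFields

namespace TestATS4LowerBound

/-- Plumbing: `Σ_{i<m} (i+1)² = m(m+1)(2m+1)/6` over `ℝ`. [folklore] -/
theorem sum_fin_val_add_one_sq (m : ℕ) : ∑ i : Fin m, (((i : ℕ) : ℝ) + 1) ^ 2 = (m : ℝ) * (m + 1) * (2 * m + 1) / 6 := by
  rw [Fin.sum_univ_eq_sum_range (fun i => ((i : ℝ) + 1) ^ 2) m]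
  induction m with
  | zero => simp
  | succ m ih =>
    rw [Finset.sum_range_succ, ih]
    push_cast
    ring

/-- A positive real with prescribed logarithm `−m·log p` is `(p⁻¹)^m`. [folklore] -/
theorem eq_inv_pow_of_log_eq {p : ℕ} (hp : 0 < p) {r : ℝ} (hr : 0 < r) {m : ℕ} (h : Real.log r = -(m : ℝ) * Real.log p) :
    r = ((p : ℝ)⁻¹) ^ m := by
  have hp0 : (0 : ℝ) < p := by exact_mod_cast hp
  refine Real.log_injOn_pos hr (pow_pos (inv_pos.mpr hp0) _) ?_
  rw [h, Real.log_pow, Real.log_inv]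
  ring

/-! ## 1. Realising ideles at data with `2l·e_v·m_q(p) = ord_v(q_v)`: the readings in numbers -/

section Realising

variable {F : Type} [Field F] [NumberField F] (X : PilotData F) {logv : PadicLogs F} (hlog : LogvAnalytic logv)
  (M : Type) [Field M] [NumberField M]
  (archPk : ∀ (j : (thetaIndex X).Label) (vQ : (thetaIndex X).VQ), Set ((logShellsDH X logv).Packet j vQ))
  (archSub : ∀ (j : (thetaIndex X).Label) (v : (thetaIndex X).V),
    Set ((logShellsDH X logv).Packet j ((thetaIndex X).over v)))
  (Ψ : ℤ → ∀ v : (thetaIndex X).V, v ∈ (thetaIndex X).Vbad → Set ((logShellsDH X logv).StarPacket v))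
  (act : ℤ → ∀ v : (thetaIndex X).V, v ∈ (thetaIndex X).Vbad →
    (logShellsDH X logv).StarPacket v → Module.End ℚ ((logShellsDH X logv).StarPacket v))
  (Mmod : ℤ → ∀ j : (thetaIndex X).LabelStar, Set ((logShellsDH X logv).GlobalPacket j.1))
  (region : ℤ → ∀ j : (thetaIndex X).LabelStar, FinDivisor M → ∀ vQ : (thetaIndex X).VQ,
    Set ((logShellsDH X logv).Packet j.1 vQ))
  (n : ℤ) {HT : Type} {LogLink : HT → HT → Type} {IsFull : ∀ {s t : HT}, LogLink s t → Prop}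
  (lat : LGPGaussianLogThetaLattice LogLink IsFull)
  {Frd : Type} {IsoF : Frd → Frd → Type} {Ob : Frd → Type} {realify : Frd → Frd} {Strip : Type}
  {IsoS : Strip → Strip → Type} {Mv : ∀ v : (thetaIndex X).V, v ∈ (thetaIndex X).Vbad → Type}
  [∀ v h, Monoid (Mv v h)]
  (sig : GlobalLGPFrobenioidSignature (thetaIndex X).lstar (thetaIndex X).V (· ∈ (thetaIndex X).Vbad)
    Frd IsoF Ob realify Strip IsoS Mv)
  (split : SplittingMonoids Mv) {ObΔ : Type} {N : ∀ v : (thetaIndex X).V, v ∈ (thetaIndex X).Vbad → Type}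
  [∀ v h, Monoid (N v h)] (qData : QPilotData ObΔ N)
  (U : Finset Nat.Primes)
  (hU : ∀ (pp : Nat.Primes) (x : (thetaIndex X).Fibre (.inr pp)),
    haveI : Fact (pp : ℕ).Prime := ⟨pp.2⟩; placeOf X pp.1 x ∈ X.S → pp ∈ U)
  (hUS : ∀ (pp : Nat.Primes), pp ∈ U → ∀ (x : (thetaIndex X).Fibre (.inr pp)),
    haveI : Fact (pp : ℕ).Prime := ⟨pp.2⟩; placeOf X pp.1 x ∈ X.S)
  (hU2 : ∀ pp ∈ U, 2 < (pp : ℕ)) (hUd : ∀ pp ∈ U, ¬ ((pp : ℕ) : ℤ) ∣ NumberField.discr F)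
  (mq : Nat.Primes → ℕ)
  (hord : ∀ (pp : Nat.Primes), pp ∈ U → ∀ (x : (thetaIndex X).Fibre (.inr pp)),
    haveI : Fact (pp : ℕ).Prime := ⟨pp.2⟩;
    (X.ordq (placeOf X pp.1 x) : ℝ) = 2 * X.l * ramIdx F (placeOf X pp.1 x) * mq pp)

include hUS hord in
/-- **The `q`-realising equation in numbers**: at a place over `p ∈ U` with `ord_v(q_v) = 2l·e_v·m_q(p)`, print's normalisation
`−P_q(v)·log|κ(v)|/n_v` (`P_q(v) = ord_v(q_v)/2l`, `log|κ(v)| = f_v log p`, `n_v = e_v f_v`) is `−m_q(p)·log p`. [cite: DupuyHilado2025, §3.3, §3.4] -/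
theorem qPilot_reading_eq_of_ord (pp : Nat.Primes) (hpp : pp ∈ U) (x : (thetaIndex X).Fibre (.inr pp)) :
    haveI : Fact (pp : ℕ).Prime := ⟨pp.2⟩;
    -(X.qPilot (placeOf X pp.1 x)) * logNorm F (placeOf X pp.1 x) / localDegree F (placeOf X pp.1 x) =
      -(mq pp : ℝ) * Real.log (pp : ℕ) := by
  haveI : Fact (pp : ℕ).Prime := ⟨pp.2⟩;
  have hres : residueChar F (placeOf X pp.1 x) = pp := (mem_placesOver_iff_residueChar _).mp (placeOf_mem X pp.1 x)
  have he0 : (ramIdx F (placeOf X pp.1 x) : ℝ) ≠ 0 := by exact_mod_cast ramIdx_ne_zero F _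
  have hf0 : (resDeg F (placeOf X pp.1 x) : ℝ) ≠ 0 := by exact_mod_cast resDeg_ne_zero F _
  have hl0 : (X.l : ℝ) ≠ 0 := by exact_mod_cast X.l_prime.ne_zero
  rw [X.qPilot_apply_of_mem (hUS pp hpp x), hord pp hpp x, logNorm_eq, hres]
  unfold localDegree
  push_cast
  field_simp

include hUS hord in
/-- **The Θ-realising equation in numbers**: `−P_{Θ,j}(v)·log|κ(v)|/n_v = −j²·m_q(p)·log p` (`P_{Θ,j} = j²·P_q`). [cite: DupuyHilado2025, §3.3, §3.4] -/
theorem thetaPilot_reading_eq_of_ord (pp : Nat.Primes) (hpp : pp ∈ U) (i : Fin X.lstar) (x : (thetaIndex X).Fibre (.inr pp)) :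
    haveI : Fact (pp : ℕ).Prime := ⟨pp.2⟩;
    -(X.thetaPilot i (placeOf X pp.1 x)) * logNorm F (placeOf X pp.1 x) / localDegree F (placeOf X pp.1 x) =
      -(((((i : ℕ) + 1) ^ 2 * mq pp : ℕ) : ℝ)) * Real.log (pp : ℕ) := by
  haveI : Fact (pp : ℕ).Prime := ⟨pp.2⟩;
  have h := qPilot_reading_eq_of_ord X U hUS mq hord pp hpp x
  rw [X.thetaPilot_eq_smul i, Finsupp.smul_apply, smul_eq_mul]
  push_cast
  have h' : -((((i : ℕ) : ℝ) + 1) ^ 2 * X.qPilot (placeOf X pp.1 x)) * logNorm F (placeOf X pp.1 x) /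
      localDegree F (placeOf X pp.1 x) =
      (((i : ℕ) : ℝ) + 1) ^ 2 * (-(X.qPilot (placeOf X pp.1 x)) * logNorm F (placeOf X pp.1 x) /
        localDegree F (placeOf X pp.1 x)) := by ring
  rw [h', h]
  ring

include hU in
/-- Off `S` (in particular over a prime outside `U`) both realising equations read `0`. [cite: DupuyHilado2025, §3.3] -/
theorem pilot_readings_eq_zero_of_not_mem (pp : Nat.Primes) (hpp : pp ∉ U) (i : Fin X.lstar) (x : (thetaIndex X).Fibre (.inr pp)) :
    haveI : Fact (pp : ℕ).Prime := ⟨pp.2⟩;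
    -(X.qPilot (placeOf X pp.1 x)) * logNorm F (placeOf X pp.1 x) / localDegree F (placeOf X pp.1 x) = 0 ∧
      -(X.thetaPilot i (placeOf X pp.1 x)) * logNorm F (placeOf X pp.1 x) / localDegree F (placeOf X pp.1 x) = 0 := by
  haveI : Fact (pp : ℕ).Prime := ⟨pp.2⟩;
  have hS : placeOf X pp.1 x ∉ X.S := fun h => hpp (hU pp x h)
  rw [X.qPilot_apply_of_not_mem hS, X.thetaPilot_apply_of_not_mem i hS]
  simp

include hUS hord in
/-- **`m_q(p) ≥ 1` on `U`**: the places over `p ∈ U` are bad, so `ord_v(q_v) > 0`, and `ord_v(q_v) = 2l·e_v·m_q(p)`. [cite: DupuyHilado2025, §3.3] -/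
theorem one_le_mq_of_ord (pp : Nat.Primes) (hpp : pp ∈ U) : 1 ≤ mq pp := by
  haveI : Fact (pp : ℕ).Prime := ⟨pp.2⟩;
  obtain ⟨w, hw⟩ := placesOver_nonempty F (pp : ℕ)
  set x : (thetaIndex X).Fibre (.inr pp) := (fibreEquivPlacesOver X pp).symm ⟨w, hw⟩ with hx
  have hpos : (0 : ℝ) < X.ordq (placeOf X pp.1 x) := by exact_mod_cast X.ordq_pos (hUS pp hpp x)
  rw [hord pp hpp x] at hpos
  refine Nat.one_le_iff_ne_zero.mpr fun h0 => ?_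
  rw [h0, Nat.cast_zero, mul_zero] at hpos
  exact lt_irrefl _ hpos

include hU hUS hord in
/-- `U` is non-empty (it carries the non-empty `S`) and `Σ_{p∈U} m_q(p)·log p > 0`. [cite: DupuyHilado2025, §3.3] -/
theorem sum_mq_log_pos : 0 < ∑ pp ∈ U, (mq pp : ℝ) * Real.log (pp : ℕ) := by
  obtain ⟨v, hv⟩ := X.S_nonempty
  set pp : Nat.Primes := ⟨residueChar F v, residueChar_prime F v⟩ with hpp
  haveI : Fact (pp : ℕ).Prime := ⟨pp.2⟩;
  have hvmem : v ∈ placesOver F (pp : ℕ) := (mem_placesOver_iff_residueChar v).mpr rfl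
  set x : (thetaIndex X).Fibre (.inr pp) := (fibreEquivPlacesOver X pp).symm ⟨v, hvmem⟩ with hx
  have hplace : placeOf X pp.1 x = v := by
    show ((fibreEquivPlacesOver X pp) ((fibreEquivPlacesOver X pp).symm ⟨v, hvmem⟩)).1 = v
    rw [Equiv.apply_symm_apply]
  have hppU : pp ∈ U := hU pp x (hplace ▸ hv)
  have hlogp : ∀ qq : Nat.Primes, 0 ≤ (mq qq : ℝ) * Real.log (qq : ℕ) :=
    fun qq => mul_nonneg (Nat.cast_nonneg _) (Real.log_nonneg (by exact_mod_cast qq.2.one_lt.le))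
  refine lt_of_lt_of_le ?_ (Finset.single_le_sum (fun qq _ => hlogp qq) hppU)
  exact mul_pos (by exact_mod_cast one_le_mq_of_ord X U hUS mq hord pp hppU)
    (Real.log_pos (by exact_mod_cast pp.2.one_lt))

/-! ## 2. ALL realising ideles: `Statement` holds, Joshi's first inequality fails for every reading datum -/

variable (t : ∀ (pp : Nat.Primes) (_ : Fin X.lstar) (x : (thetaIndex X).Fibre (.inr pp)),
    haveI : Fact (pp : ℕ).Prime := ⟨pp.2⟩; kOf X pp.1 x)
  (tq : ∀ (pp : Nat.Primes) (x : (thetaIndex X).Fibre (.inr pp)), haveI : Fact (pp : ℕ).Prime := ⟨pp.2⟩; kOf X pp.1 x)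
  (ht0 : ∀ pp i x, t pp i x ≠ 0)
  (ht1 : ∀ (pp : Nat.Primes) (i : Fin X.lstar) (x : (thetaIndex X).Fibre (.inr pp)),
    haveI : Fact (pp : ℕ).Prime := ⟨pp.2⟩; placeOf X pp.1 x ∉ X.S → ‖t pp i x‖ = 1)
  (htq0 : ∀ pp x, tq pp x ≠ 0)
  (htq1 : ∀ (pp : Nat.Primes) (x : (thetaIndex X).Fibre (.inr pp)),
    haveI : Fact (pp : ℕ).Prime := ⟨pp.2⟩; placeOf X pp.1 x ∉ X.S → ‖tq pp x‖ = 1)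
  (ht : ∀ (pp : Nat.Primes) (i : Fin X.lstar) (x : (thetaIndex X).Fibre (.inr pp)),
    haveI : Fact (pp : ℕ).Prime := ⟨pp.2⟩;
    Real.log ‖t pp i x‖ = -(X.thetaPilot i (placeOf X pp.1 x)) * logNorm F (placeOf X pp.1 x) /
      localDegree F (placeOf X pp.1 x))
  (htq : ∀ (pp : Nat.Primes) (x : (thetaIndex X).Fibre (.inr pp)),
    haveI : Fact (pp : ℕ).Prime := ⟨pp.2⟩;
    Real.log ‖tq pp x‖ = -(X.qPilot (placeOf X pp.1 x)) * logNorm F (placeOf X pp.1 x) /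
      localDegree F (placeOf X pp.1 x))

include hUS hord htq0 htq in
/-- Realising `q`-ideles are exponent-shaped: `‖t_{q,v}‖ = ‖p^{m_q(p)}‖` over `p ∈ U`. [cite: DupuyHilado2025, §3.3, §3.4] -/
theorem norm_qIdele_eq_of_realising (pp : Nat.Primes) (hpp : pp ∈ U) (x : (thetaIndex X).Fibre (.inr pp)) :
    haveI : Fact (pp : ℕ).Prime := ⟨pp.2⟩; ‖tq pp x‖ = ‖((pp : ℕ) : ℚ_[pp]) ^ ((mq pp : ℕ) : ℤ)‖ := by
  haveI : Fact (pp : ℕ).Prime := ⟨pp.2⟩;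
  have h := htq pp x
  rw [qPilot_reading_eq_of_ord X U hUS mq hord pp hpp x] at h
  rw [zpow_natCast, norm_pow, Padic.norm_p]
  exact eq_inv_pow_of_log_eq pp.2.pos (norm_pos_iff.mpr (htq0 pp x)) h

include hUS hord ht0 ht htq0 htq in
/-- Realising Θ-ideles are exponent-shaped with the SHARP exponents `j²·m_q(p)` ([IUTchIII] Rmk. 3.1.1):
`‖t_{Θ,j,v}‖ = ‖p^{j²m_q(p)}‖` over `p ∈ U`. [cite: DupuyHilado2025, §3.3, §3.4] [claim: Mochizuki2012, status: disputed] -/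
theorem norm_thetaIdele_eq_of_realising (pp : Nat.Primes) (hpp : pp ∈ U) (i : Fin (thetaIndex X).lstar)
    (x : (thetaIndex X).Fibre (.inr pp)) :
    haveI : Fact (pp : ℕ).Prime := ⟨pp.2⟩;
    ‖t pp i x‖ = ‖((pp : ℕ) : ℚ_[pp]) ^ ((((i : ℕ) + 1) ^ 2 * mq pp : ℕ) : ℤ)‖ := by
  haveI : Fact (pp : ℕ).Prime := ⟨pp.2⟩;
  rw [norm_thetaIdele_eq_pow_of_realises X t ht0 ht tq htq0 htq pp i x,
    norm_qIdele_eq_of_realising X U hUS mq hord tq htq0 htq pp hpp x, zpow_natCast, zpow_natCast, norm_pow, norm_pow,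
    Padic.norm_p, ← pow_mul, mul_comm]

include hU hUS hU2 hUd hord ht0 ht1 ht htq in
/-- **THE LOCATED CONVERSE OF Y-21ℓ WITH REALISING IDELES.** Pilot data `X` over `F` whose bad places fill the fibres over a finite set
`U` of ODD primes UNRAMIFIED in `F`, with `ord_v(q_v) = 2l·e_v·m_q(p)` over `p ∈ U`; pilot ideles REALISING `P_Θ`, `P_q` in print's
normalisation (`ht`, `htq` BY NAME), units off `S`; ONE prime `p₀` with a SINGLE place `v₀` of `F` above it, of ramification index
`e ≥ 2`; and the explicit inequality **`((ℓ⋆+1)(2ℓ⋆+1)/6 − 1)·Σ_{p∈U} m_q(p)·log p ≤ ((e−1)/e)·((ℓ⋆+1)/2)·log p₀`**. Then for every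
Thm-3.11 context: **OUR typed [IUTchIII] Cor. 3.12 `Statement` HOLDS; Joshi's [J-III] Cor 9.11.1.1 read through the dictionary
FAILS (`¬ A.Cor91111`) for EVERY adelic Θ-values-locus datum `A` on `s = U` reading the genuine `q`-volumes and hull volumes; and such
a reading datum EXISTS.** The exponent gap `((ℓ⋆+1)(2ℓ⋆+1)/6 − 1)·Σ_p m_q(p)·log p` is `> 0` (§1) and `≤ −|log(Θ)|(𝟙)` by the
QUANTITATIVE ramified hull gain (part II `gain_le_negLogTheta_settingPrVolSharp_trivial_of_unique`); p463394's
`statement_iff_gap_le_trivial` / `cor91111_iff_gap_nonpos` convert. No side taken; the Statement holds BY (Ind1)/(Ind2)-INFLATION of the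
unit boxes at the ramified packet. [claim: Joshi2024ATS3, status: disputed] [claim: Mochizuki2012, status: disputed]
[cite: DupuyHilado2025, §3.3, §3.4, §3.6, §3.9, §4.7, §4.9] [cite: NeukirchANT1999, Ch. II Prop. (6.8)] -/
theorem statement_and_not_cor91111_of_realising (p₀ : Nat.Primes) (v₀ : HeightOneSpectrum (𝓞 F))
    (hv₀ : (thetaIndex X).over (.inr v₀) = .inr p₀) (hvp₀ : ((p₀ : ℕ) : 𝓞 F) ∈ v₀.asIdeal)
    (he₀ : haveI : Fact (p₀ : ℕ).Prime := ⟨p₀.2⟩; 2 ≤ absRamificationIdx (p₀ : ℕ) (RescaledCompletion F (p₀ : ℕ) v₀ hvp₀))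
    (huniq₀ : ∀ w ∈ placesOver F (p₀ : ℕ), w = v₀)
    (hnum : haveI : Fact (p₀ : ℕ).Prime := ⟨p₀.2⟩
      ((((thetaIndex X).lstar : ℝ) + 1) * (2 * (thetaIndex X).lstar + 1) / 6 - 1) *
          ∑ pp ∈ U, (mq pp : ℝ) * Real.log (pp : ℕ) ≤
        (((absRamificationIdx (p₀ : ℕ) (RescaledCompletion F (p₀ : ℕ) v₀ hvp₀) : ℝ) - 1) /
            (absRamificationIdx (p₀ : ℕ) (RescaledCompletion F (p₀ : ℕ) v₀ hvp₀) : ℝ)) *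
          ((((thetaIndex X).lstar : ℝ) + 1) / 2) * Real.log (p₀ : ℕ))
    (s : Finset (thetaIndex X).VQ) (hs : ∀ w, w ∈ s ↔ ∃ pp ∈ U, w = Sum.inr pp) :
    (settingPrVolSharp X hlog M archPk archSub Ψ act Mmod region n lat sig split qData tq t htq0 htq1).Statement ∧
      (∀ A : ATS3.AdelicLocusDatum (thetaIndex X).lstar s,
        (∀ (i : Fin (thetaIndex X).lstar) (w : s), Real.log (A.loc w).qroot =
          (settingPrVolSharp X hlog M archPk archSub Ψ act Mmod region n lat sig split qData tq t htq0 htq1).qLocal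
            (Setting.labelSucc i) w) →
        (∀ w : s, Real.log (A.loc w).hullVol =
          ∑ i : Fin (thetaIndex X).lstar, ((situationPrVol X hlog M archPk archSub Ψ act Mmod region).D n).logvol
            (Setting.labelSucc i) w
            ((settingPrVolSharp X hlog M archPk archSub Ψ act Mmod region n lat sig split qData tq t htq0 htq1).thetaHull
              (Setting.labelSucc i) w)) →
        ¬ A.Cor91111) ∧
      ∃ A : ATS3.AdelicLocusDatum (thetaIndex X).lstar s,
        (∀ (i : Fin (thetaIndex X).lstar) (w : s), Real.log (A.loc w).qroot =
          (settingPrVolSharp X hlog M archPk archSub Ψ act Mmod region n lat sig split qData tq t htq0 htq1).qLocal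
            (Setting.labelSucc i) w) ∧
        (∀ w : s, Real.log (A.loc w).hullVol =
          ∑ i : Fin (thetaIndex X).lstar, ((situationPrVol X hlog M archPk archSub Ψ act Mmod region).D n).logvol
            (Setting.labelSucc i) w
            ((settingPrVolSharp X hlog M archPk archSub Ψ act Mmod region n lat sig split qData tq t htq0 htq1).thetaHull
              (Setting.labelSucc i) w)) := by
  haveI : Fact (p₀ : ℕ).Prime := ⟨p₀.2⟩
  have hl : 0 < (thetaIndex X).lstar := lt_of_lt_of_le two_pos (thetaIndex X).two_le_lstar
  have hlR : (0 : ℝ) < (thetaIndex X).lstar := by exact_mod_cast hl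
  have hl2 : (2 : ℝ) ≤ (thetaIndex X).lstar := by exact_mod_cast (thetaIndex X).two_le_lstar
  -- the exponent shape of the realising ideles
  set mΘ : Nat.Primes → Fin (thetaIndex X).lstar → ℕ := fun pp i => ((i : ℕ) + 1) ^ 2 * mq pp with hmΘ
  have hmq : ∀ (pp : Nat.Primes), pp ∈ U → ∀ (x : (thetaIndex X).Fibre (.inr pp)),
      haveI : Fact (pp : ℕ).Prime := ⟨pp.2⟩; ‖tq pp x‖ = ‖((pp : ℕ) : ℚ_[pp]) ^ ((mq pp : ℕ) : ℤ)‖ :=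
    fun pp hpp x => norm_qIdele_eq_of_realising X U hUS mq hord tq htq0 htq pp hpp x
  have hm : ∀ (pp : Nat.Primes), pp ∈ U → ∀ (i : Fin (thetaIndex X).lstar) (x : (thetaIndex X).Fibre (.inr pp)),
      haveI : Fact (pp : ℕ).Prime := ⟨pp.2⟩; ‖t pp i x‖ = ‖((pp : ℕ) : ℚ_[pp]) ^ ((mΘ pp i : ℕ) : ℤ)‖ :=
    fun pp hpp i x => norm_thetaIdele_eq_of_realising X U hUS mq hord t tq ht0 htq0 ht htq pp hpp i x
  -- the exponent gap in closed form
  have hgap : (∑ pp ∈ U, ∑ i : Fin (thetaIndex X).lstar, (mΘ pp i : ℝ) * Real.log (pp : ℕ)) / (thetaIndex X).lstar -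
      ∑ pp ∈ U, (mq pp : ℝ) * Real.log (pp : ℕ) =
      ((((thetaIndex X).lstar : ℝ) + 1) * (2 * (thetaIndex X).lstar + 1) / 6 - 1) *
        ∑ pp ∈ U, (mq pp : ℝ) * Real.log (pp : ℕ) := by
    have hinner : ∀ pp : Nat.Primes, ∑ i : Fin (thetaIndex X).lstar, (mΘ pp i : ℝ) * Real.log (pp : ℕ) =
        (((thetaIndex X).lstar : ℝ) * ((thetaIndex X).lstar + 1) * (2 * (thetaIndex X).lstar + 1) / 6) *
          ((mq pp : ℝ) * Real.log (pp : ℕ)) := by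
      intro pp
      have hre : ∀ i : Fin (thetaIndex X).lstar, (mΘ pp i : ℝ) * Real.log (pp : ℕ) =
          ((((i : ℕ) : ℝ) + 1) ^ 2) * ((mq pp : ℝ) * Real.log (pp : ℕ)) := fun i => by
        simp only [hmΘ]; push_cast; ring
      simp_rw [hre]
      rw [← Finset.sum_mul, sum_fin_val_add_one_sq]
    simp_rw [hinner]
    rw [← Finset.mul_sum]
    field_simp
  -- the gap is positive …
  have hsum_pos := sum_mq_log_pos X U hU hUS mq hord
  have hC : 0 < (((thetaIndex X).lstar : ℝ) + 1) * (2 * (thetaIndex X).lstar + 1) / 6 - 1 := by nlinarith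
  have hgap_pos : 0 < (∑ pp ∈ U, ∑ i : Fin (thetaIndex X).lstar, (mΘ pp i : ℝ) * Real.log (pp : ℕ)) / (thetaIndex X).lstar -
      ∑ pp ∈ U, (mq pp : ℝ) * Real.log (pp : ℕ) := by
    rw [hgap]; exact mul_pos hC hsum_pos
  -- … and inside the inflation window
  have hwin := TestATS4HullGain.gain_le_negLogTheta_settingPrVolSharp_trivial_of_unique X hlog M archPk archSub Ψ act Mmod region
    n lat sig split qData p₀ v₀ hv₀ hvp₀ he₀ huniq₀
  have hgap_le : (((∑ pp ∈ U, ∑ i : Fin (thetaIndex X).lstar, (mΘ pp i : ℝ) * Real.log (pp : ℕ)) / (thetaIndex X).lstar -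
        ∑ pp ∈ U, (mq pp : ℝ) * Real.log (pp : ℕ) : ℝ) : WithTop ℝ) ≤
      (settingPrVolSharp X hlog M archPk archSub Ψ act Mmod region n lat sig split qData (fun _ _ => 1) (fun _ _ _ => 1)
        (fun _ _ => one_ne_zero) (fun _ _ _ => norm_one)).negLogTheta := by
    refine le_trans (WithTop.coe_le_coe.mpr ?_) hwin
    rw [hgap]
    exact hnum
  refine ⟨?_, fun A hq hV => ?_, ?_⟩
  · exact (statement_iff_gap_le_trivial X hlog M archPk archSub Ψ act Mmod region n lat sig split qData t tq ht0 ht1 htq0 htq1 U hU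
      hU2 hUd mΘ mq hm hmq).mpr hgap_le
  · rw [cor91111_iff_gap_nonpos X hlog M archPk archSub Ψ act Mmod region n lat sig split qData t tq ht0 ht1 htq0 htq1 U hU2 hUd mΘ
      mq hm hmq s hs A hq hV]
    exact not_le.mpr hgap_pos
  · exact exists_adelicLocusDatum_reading X hlog M archPk archSub Ψ act Mmod region n lat sig split qData t tq htq0 htq1 U mq hmq s hs
      (fun pp hpp => one_le_mq_of_ord X U hUS mq hord pp hpp)

/-! ## 3. NON-VACUITY: realising ideles exist at such data -/

include hU hUS hord in
/-- **Realising ideles EXIST** at pilot data with `ord_v(q_v) = 2l·e_v·m_q(p)` over the primes `p ∈ U` carrying `S`: `t_{q,v} := p^{m_q(p)}`,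
`t_{Θ,j,v} := p^{j²·m_q(p)}` over `U` and units elsewhere are non-zero, units off `S`, and satisfy print's normalisation `ht`/`htq`
(so §2 is NOT vacuous). [cite: DupuyHilado2025, §3.3, §3.4] [claim: Mochizuki2012, status: disputed] (Rmk. 3.1.1 exponents) -/
theorem exists_realising_ideles :
    ∃ (tq : ∀ (pp : Nat.Primes) (x : (thetaIndex X).Fibre (.inr pp)), haveI : Fact (pp : ℕ).Prime := ⟨pp.2⟩; kOf X pp.1 x)
      (t : ∀ (pp : Nat.Primes) (_ : Fin X.lstar) (x : (thetaIndex X).Fibre (.inr pp)),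
        haveI : Fact (pp : ℕ).Prime := ⟨pp.2⟩; kOf X pp.1 x),
      (∀ pp x, tq pp x ≠ 0) ∧
      (∀ (pp : Nat.Primes) (x : (thetaIndex X).Fibre (.inr pp)),
        haveI : Fact (pp : ℕ).Prime := ⟨pp.2⟩; placeOf X pp.1 x ∉ X.S → ‖tq pp x‖ = 1) ∧
      (∀ pp i x, t pp i x ≠ 0) ∧
      (∀ (pp : Nat.Primes) (i : Fin X.lstar) (x : (thetaIndex X).Fibre (.inr pp)),
        haveI : Fact (pp : ℕ).Prime := ⟨pp.2⟩; placeOf X pp.1 x ∉ X.S → ‖t pp i x‖ = 1) ∧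
      (∀ (pp : Nat.Primes) (i : Fin X.lstar) (x : (thetaIndex X).Fibre (.inr pp)),
        haveI : Fact (pp : ℕ).Prime := ⟨pp.2⟩;
        Real.log ‖t pp i x‖ = -(X.thetaPilot i (placeOf X pp.1 x)) * logNorm F (placeOf X pp.1 x) /
          localDegree F (placeOf X pp.1 x)) ∧
      (∀ (pp : Nat.Primes) (x : (thetaIndex X).Fibre (.inr pp)),
        haveI : Fact (pp : ℕ).Prime := ⟨pp.2⟩;
        Real.log ‖tq pp x‖ = -(X.qPilot (placeOf X pp.1 x)) * logNorm F (placeOf X pp.1 x) /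
          localDegree F (placeOf X pp.1 x)) := by
  classical
  let tq : ∀ (pp : Nat.Primes) (x : (thetaIndex X).Fibre (.inr pp)), haveI : Fact (pp : ℕ).Prime := ⟨pp.2⟩; kOf X pp.1 x :=
    fun pp x => haveI : Fact (pp : ℕ).Prime := ⟨pp.2⟩; if pp ∈ U then ((pp : ℕ) : kOf X pp.1 x) ^ (mq pp) else 1
  let t : ∀ (pp : Nat.Primes) (_ : Fin X.lstar) (x : (thetaIndex X).Fibre (.inr pp)),
      haveI : Fact (pp : ℕ).Prime := ⟨pp.2⟩; kOf X pp.1 x :=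
    fun pp i x => haveI : Fact (pp : ℕ).Prime := ⟨pp.2⟩; if pp ∈ U then ((pp : ℕ) : kOf X pp.1 x) ^ (((i : ℕ) + 1) ^ 2 * mq pp) else 1
  have htq_norm : ∀ (pp : Nat.Primes) (x : (thetaIndex X).Fibre (.inr pp)), haveI : Fact (pp : ℕ).Prime := ⟨pp.2⟩;
      ‖tq pp x‖ = if pp ∈ U then (((pp : ℕ) : ℝ)⁻¹) ^ (mq pp) else 1 := by
    intro pp x
    haveI : Fact (pp : ℕ).Prime := ⟨pp.2⟩;
    change ‖(if pp ∈ U then ((pp : ℕ) : kOf X pp.1 x) ^ (mq pp) else 1)‖ = _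
    by_cases h : pp ∈ U
    · rw [if_pos h, if_pos h]; exact norm_natCast_pow_kOf X pp x _
    · rw [if_neg h, if_neg h, norm_one]
  have ht_norm : ∀ (pp : Nat.Primes) (i : Fin X.lstar) (x : (thetaIndex X).Fibre (.inr pp)), haveI : Fact (pp : ℕ).Prime := ⟨pp.2⟩;
      ‖t pp i x‖ = if pp ∈ U then (((pp : ℕ) : ℝ)⁻¹) ^ (((i : ℕ) + 1) ^ 2 * mq pp) else 1 := by
    intro pp i x
    haveI : Fact (pp : ℕ).Prime := ⟨pp.2⟩;
    change ‖(if pp ∈ U then ((pp : ℕ) : kOf X pp.1 x) ^ (((i : ℕ) + 1) ^ 2 * mq pp) else 1)‖ = _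
    by_cases h : pp ∈ U
    · rw [if_pos h, if_pos h]; exact norm_natCast_pow_kOf X pp x _
    · rw [if_neg h, if_neg h, norm_one]
  have hinv0 : ∀ pp : Nat.Primes, (0 : ℝ) < ((pp : ℕ) : ℝ)⁻¹ := fun pp => inv_pos.mpr (by exact_mod_cast pp.2.pos)
  have hnot : ∀ (pp : Nat.Primes) (x : (thetaIndex X).Fibre (.inr pp)),
      haveI : Fact (pp : ℕ).Prime := ⟨pp.2⟩; placeOf X pp.1 x ∉ X.S → pp ∉ U := fun pp x hx hpp => hx (hUS pp hpp x)
  refine ⟨tq, t, fun pp x => norm_pos_iff.mp ?_, fun pp x hx => ?_, fun pp i x => norm_pos_iff.mp ?_, fun pp i x hx => ?_,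
    fun pp i x => ?_, fun pp x => ?_⟩
  · rw [htq_norm]; split_ifs
    · exact pow_pos (hinv0 pp) _
    · exact one_pos
  · rw [htq_norm, if_neg (hnot pp x hx)]
  · rw [ht_norm]; split_ifs
    · exact pow_pos (hinv0 pp) _
    · exact one_pos
  · rw [ht_norm, if_neg (hnot pp x hx)]
  · rw [ht_norm]
    by_cases hpp : pp ∈ U
    · rw [if_pos hpp, thetaPilot_reading_eq_of_ord X U hUS mq hord pp hpp i x, Real.log_pow, Real.log_inv]
      push_cast
      ring
    · rw [if_neg hpp, Real.log_one, (pilot_readings_eq_zero_of_not_mem X U hU pp hpp i x).2]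
  · rw [htq_norm]
    by_cases hpp : pp ∈ U
    · rw [if_pos hpp, qPilot_reading_eq_of_ord X U hUS mq hord pp hpp x, Real.log_pow, Real.log_inv]
      ring
    · have hl : 0 < X.lstar := lt_of_lt_of_le two_pos X.two_le_lstar
      rw [if_neg hpp, Real.log_one, (pilot_readings_eq_zero_of_not_mem X U hU pp hpp ⟨0, hl⟩ x).1]

end Realising

end TestATS4LowerBound

end Summit.ABC.IUTFork.Joshi

end
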